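import Summits.BirchSwinnertonDyer.BirchSwinnertonDyer.Theorems.SignedLowerHalvesSmallImageLowerHalfBothSignsRttJunctionShaGlue
import Summits.BirchSwinnertonDyer.BirchSwinnertonDyer.Theorems.SignedLowerHalvesSmallImageLowerHalfBothSignsRttJunctionShaAlpha1
import Summits.BirchSwinnertonDyer.BirchSwinnertonDyer.Theorems.SignedLowerHalvesSmallImageLowerHalfBothSignsRttJunctionLambdaStrictDualFinite
import HarnessLib

/-!
# Route `SignedLowerHalves`, crux L `SmallImageLowerHalfBothSigns` (stmt-BirchSwinnertonDyer-23599), line `rtt_w3` v29 → v30 — ROW S3α FROM ITS POITOU–TATE CORE (S3α′), LEAD g14: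
# `λ(H²₂/T₂) ≤ λ(Y′)` ⟸ «`ρ : 𝐇²_{Iw,P} → Loc` finite-target, `π : Y′ → 𝐇²_{Iw,P}` with `ker ρ ≤ range π`» + α1 + the hypothesis-free Ш-socket + `Y′` f.g. torsion

WHY (LEAD `cruxlead-stmt-BirchSwinnertonDyer-23599` g14, HELPER-TABLE addenda 28/29). Row S3α of the line is `lamH2f ≤ JunctionLamY …`, i.e.
`λ_Λ(QuotSMulTop (C (X − C 0)) D₂'.H) ≤ λ_Λ(Y′)` with `Y′ = Hom(strictSelmer … (S₀K ∪ {w ∣ p}), ℚ/ℤ)` under lambda-p1's `strictDualModule` (p807576). Three of its four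
bricks are in the tree: α1 (honda g27 `SmallImageRttJunctionSha.junctionSha_alpha1`, p813152: `sp² : H²₂/T₂ ↪ I₂.H` injective, `Λ_𝒪`-linear for the line's
`Module.compHom _ (PowerSeries.map C)`), the Ш-socket WITHOUT finiteness/torsion hypotheses on `𝐇²_{Iw}`/`Ш²` (LEAD g14 `lambdaInvariant_le_of_sha_range_of_finite`, p812938) and
`Y′` f.g. torsion (lambda-p1 `moduleFinite_strictDual`/`isTorsion_strictDual`). THIS FILE assembles them: S3α follows from the remaining POITOU–TATE CORE

  (S3α′)  for honda's pinned degree-2 cyclotomic datum `I₂ : CycIwasawaCohomologyDataO S κc γK⁻¹ θ′ (suppPF p 𝔣) 2` there are a `Λ`-module `Loc` that is FINITE, a `Λ`-linear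
          `ρ : I₂.H → Loc` and a `Λ`-linear `π : Y′ → I₂.H` with `ker ρ ≤ range π`

(witness, HELPER-TABLE add. 28: `ρ` = the degree-2 semilocal localisation, finite target by local duality (2,0) + (R); `π` = the Poitou–Tate map `Y′ = Ш¹(A)^∨ ≅ Ш² ↪ 𝐇²`),
which becomes the line's registered stub `stub_junctionShaPT_ns` (v30); the skeleton's assembly calls ★★ `lambdaInvariant_quot_le_strictDual_of_PT` below BY NAME.
THEOREMS ONLY (`--supports stmt-BirchSwinnertonDyer-23599` helper); closes nothing; S3α′, S3β, S4′, crux L, crux M and BSD remain OPEN and are proved for NO curve by any of this.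
[cite: Kobayashi2003, Thm. 7.3 i)] [cite: PerrinRiou1994Invent, §1.3] [cite: NeukirchSchmidtWingberg2008, Ch. VIII §6 (8.6.10)] [cite: Washington1997, §13.2]
-/

set_option autoImplicit false
-- the Theorems namespace of this sub repeats the summit name by design (D-0017 nested layout)
set_option linter.dupNamespace false

noncomputable section

open scoped NumberField
open Field IsDedekindDomain NumberField
open Literature.NumberTheory.GaloisRepresentations
open Literature.NumberTheory.EllipticCurves
open Literature.NumberTheory.ComplexMultiplication.EllipticUnits (IwasawaAlgebraO₂)
open Literature.NumberTheory.ComplexMultiplication.EllipticUnits.JohnsonLeungKings2011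
open Summit.BirchSwinnertonDyer.BirchSwinnertonDyer.Theorems.SmallImageRttD2J1
open Summit.BirchSwinnertonDyer.BirchSwinnertonDyer.Theorems.SmallImageCharSignedSelmer

namespace Summit.BirchSwinnertonDyer.BirchSwinnertonDyer.Theorems.SmallImageRttJunctionSha

variable {K : Type} [Field K] [NumberField K] {p : ℕ} [Fact p.Prime] (S : Set (PadicAlgCl p)) [FiniteDimensional ℚ_[p] (padicCoeffField S)]
  (κ₁ κ₂ : ZpExtension K p) {γK γ₂ : absoluteGaloisGroup K} (hγK : κ₁.IsTopGenerator γK)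
  (θ' : absoluteGaloisGroup K →ₜ* (padicCoeffIntegers S)ˣ) (𝔣 : Ideal (𝓞 K))
  {M : Type} [AddCommGroup M] [DistribMulAction (absoluteGaloisGroup K) M] [TopologicalSpace M] [DiscreteTopology M] [Module (padicCoeffIntegers S) M]
  {V : WeierstrassCurve K} {j : V.geomPrimaryTorsion p →+ M} {S₀ : Set (HeightOneSpectrum (𝓞 K))} {ε : ℤˣ}
  (Dψ : SignedTransportDualDataSat κ₁ γK M (padicCoeffIntegers S) V j S₀ ε) (S₁ : Set (HeightOneSpectrum (𝓞 K)))
  (htorM : ∀ m : M, ∃ k : ℕ, p ^ k • m = 0)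
  (hstab : ∀ m : M, IsOpen (MulAction.stabilizer (absoluteGaloisGroup K) m : Set (absoluteGaloisGroup K)))

/-- ★★ **ROW S3α FROM ITS POITOU–TATE CORE.** For a generator pair up to units (`hγ`), `𝔣 ≠ 0`, a pinned two-variable datum `D₂'` in degree `2` (the frame's), a signed
transport dual datum `Dψ` whose `X` is f.g. torsion over `Λ` (the prefix's `hfin`/`htor`), and the POITOU–TATE CORE `hPT` (for every pinned degree-2 cyclotomic datum `I₂`:
a finite-target `Λ`-linear `ρ` on `I₂.H` and a `Λ`-linear `π : Y′ → I₂.H` with `ker ρ ≤ range π`, `Y′ = Hom(strictSelmer … S₁, ℚ/ℤ)` under `strictDualModule … hγK`):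
`λ_Λ(QuotSMulTop (C (X − C 0)) D₂'.H) ≤ λ_Λ(Y′)` for the line's `Module.compHom` structures. Proof: honda's `I₂` exists (`nonempty_cycIwasawaCohomologyDataO`), `sp²` is
injective (α1), and the Ш-socket `lambdaInvariant_le_of_sha_range_of_finite` applies with `Y′` f.g. torsion. [cite: Kobayashi2003, Thm. 7.3 i)]
[cite: NeukirchSchmidtWingberg2008, Ch. VIII §6 (8.6.10)] [cite: Washington1997, §13.2] -/
theorem lambdaInvariant_quot_le_strictDual_of_PT
    (hγ : ∃ u₁ u₂ : ℤ_[p]ˣ, ZpExtension.IsTopGeneratorPair (κ₁.unitTwist u₁) (κ₂.unitTwist u₂) γK⁻¹ γ₂) (h𝔣 : 𝔣 ≠ ⊥)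
    (D₂' : IwasawaCohomologyDataO S κ₁ κ₂ γK⁻¹ γ₂ θ' 𝔣 2)
    [Module.Finite (IwasawaAlgebra p) Dψ.X] (htor : Module.IsTorsion (IwasawaAlgebra p) Dψ.X)
    (hPT : ∀ I₂ : CycIwasawaCohomologyDataO S κ₁ γK⁻¹ θ' (suppPF p 𝔣) 2,
      letI := I₂.moduleIwasawa
      letI := SmallImageRttD2Seq.strictDualModule κ₁ (padicCoeffIntegers S) V j S₀ ε S₁ htorM hstab hγK
      ∃ (Loc : Type) (_ : AddCommGroup Loc) (_ : Module (IwasawaAlgebra p) Loc) (_ : Finite Loc)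
        (ρ : I₂.H →ₗ[IwasawaAlgebra p] Loc)
        (π : (↥(SmallImageRttD2Seq.strictSelmer κ₁ M (padicCoeffIntegers S) V j S₀ ε S₁) →+ AddCircle (1 : ℚ)) →ₗ[IwasawaAlgebra p] I₂.H),
        LinearMap.ker ρ ≤ LinearMap.range π) :
    letI : Module (IwasawaAlgebra p) (QuotSMulTop (PowerSeries.C (PowerSeries.X - PowerSeries.C (0 : padicCoeffIntegers S)) : IwasawaAlgebraO₂ S) D₂'.H) :=
      Module.compHom _ ((PowerSeries.map (PowerSeries.C : padicCoeffIntegers S →+* IwasawaAlgebraO S)).comp (iwasawaToIwasawaO S))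
    letI := SmallImageRttD2Seq.strictDualModule κ₁ (padicCoeffIntegers S) V j S₀ ε S₁ htorM hstab hγK
    lambdaInvariant p (QuotSMulTop (PowerSeries.C (PowerSeries.X - PowerSeries.C (0 : padicCoeffIntegers S)) : IwasawaAlgebraO₂ S) D₂'.H) ≤
      lambdaInvariant p (↥(SmallImageRttD2Seq.strictSelmer κ₁ M (padicCoeffIntegers S) V j S₀ ε S₁) →+ AddCircle (1 : ℚ)) := by
  letI : Algebra (IwasawaAlgebra p) (IwasawaAlgebraO S) := (iwasawaToIwasawaO S).toAlgebra
  letI instO : Module (IwasawaAlgebraO S) (QuotSMulTop (PowerSeries.C (PowerSeries.X - PowerSeries.C (0 : padicCoeffIntegers S)) : IwasawaAlgebraO₂ S) D₂'.H) :=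
    Module.compHom _ (PowerSeries.map (PowerSeries.C : padicCoeffIntegers S →+* IwasawaAlgebraO S))
  letI inst2 : Module (IwasawaAlgebra p) (QuotSMulTop (PowerSeries.C (PowerSeries.X - PowerSeries.C (0 : padicCoeffIntegers S)) : IwasawaAlgebraO₂ S) D₂'.H) :=
    Module.compHom _ ((PowerSeries.map (PowerSeries.C : padicCoeffIntegers S →+* IwasawaAlgebraO S)).comp (iwasawaToIwasawaO S))
  haveI : IsScalarTower (IwasawaAlgebra p) (IwasawaAlgebraO S) (QuotSMulTop (PowerSeries.C (PowerSeries.X - PowerSeries.C (0 : padicCoeffIntegers S)) : IwasawaAlgebraO₂ S) D₂'.H) :=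
    IsScalarTower.of_algebraMap_smul fun _ _ ↦ rfl
  letI instY := SmallImageRttD2Seq.strictDualModule κ₁ (padicCoeffIntegers S) V j S₀ ε S₁ htorM hstab hγK
  show lambdaInvariant p (QuotSMulTop (PowerSeries.C (PowerSeries.X - PowerSeries.C (0 : padicCoeffIntegers S)) : IwasawaAlgebraO₂ S) D₂'.H) ≤
      lambdaInvariant p (↥(SmallImageRttD2Seq.strictSelmer κ₁ M (padicCoeffIntegers S) V j S₀ ε S₁) →+ AddCircle (1 : ℚ))
  -- honda's degree-2 model and the Poitou–Tate core
  obtain ⟨I₂⟩ := nonempty_cycIwasawaCohomologyDataO (S := S) (κ := κ₁) (γ := γK⁻¹) (θ := θ') (P := suppPF p 𝔣) (i := 2) le_rfl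
  letI := I₂.moduleIwasawa
  haveI := I₂.isScalarTower_moduleIwasawa
  obtain ⟨Loc, _, _, _, ρ, π, hπ⟩ := hPT I₂
  -- α1: `sp²` injective (honda g27)
  obtain ⟨e₂, he₂, -⟩ := junctionSha_alpha1 S κ₁ κ₂ θ' 𝔣 hγ h𝔣 D₂' I₂
  -- `Y′` f.g. torsion (lambda-p1 g0)
  haveI := SmallImageRttD2Seq.moduleFinite_strictDual Dψ S₁ htorM hstab hγK
  have hYt := SmallImageRttD2Seq.isTorsion_strictDual Dψ S₁ htorM hstab hγK htor
  -- the Ш-socket (LEAD g14)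
  exact SmallImageRttCharRoad.lambdaInvariant_le_of_sha_range_of_finite (e₂.restrictScalars (IwasawaAlgebra p)) he₂ ρ π hπ hYt

end Summit.BirchSwinnertonDyer.BirchSwinnertonDyer.Theorems.SmallImageRttJunctionSha
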